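import Summits.AtomisticToContinuum.Crystallization.Theorems.ChartedZeroExcessLayeredLatticeLiouvilleZZZYJ

/-!
# ChartedZeroExcess · LayeredLatticeLiouville ZZZYK (lens-2 g94 NODE 94 «HessianChord», PART B) — THE BREGMAN COERCIVITY (BCᴸ′) CUT INTO THE CHORD CALCULUS
# OF THE CLAMPED ENERGY (C2ᴸ) AND THE STABILITY OF ITS PRE-STRESSED HESSIAN FORM ALONG SOFT CHORDS (HSᴸ); GLUE PROVED BY ONE-VARIABLE TAYLOR; DOOR W2i.
Docket `stmt-AtomisticToContinuum-26636` (crux `ChartedZeroExcessLayered`), W2 line; residual of record after g93 (critic r1643 (B)): (X1ᴸ′), (X2ᴸ′), (KAᴸ′),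
(BCᴸ′) `SoftBregmanCoerciveP … c`, (OGʰ′⋆), door `mildCoherentMoatCorePG_W2h` (tree ZZZYI); PART A (ZZZYJ): `ljSecondDeriv`, `bondHess`, `clampedHessForm`, WINDOW-PIN.
THIS FILE (all PROVED, 0 sorry) — THE CUT, one implication layer beneath (BCᴸ′), two typed pieces, glue PROVED:
* **(C2ᴸ) `ChordCalculusP`** — ANALYTIC · ROUTINE: along every chord `t ↦ y + t•(z − y)` from the critical filling `y` to a soft fat-tube `z` the clamped
  energy is twice differentiable, with second derivative `clampedHessForm (S ∖ core) (y + t•(z − y)) (z − y)`;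
* **(HSᴸ) `SoftHessianStableP … c`** — THE CONTENT: along those chords `2c · pairDevSq Rg (lab ∘ xf) y z ≤ clampedHessForm …` (clamped pre-stressed harmonic
  stability in the `pairDevSq` metric; the certificate target «H − c·G ≽ 0» of CRITIC-LEDGER row 1643 (c); instrument «SoftHessian-T»);
* GLUE `softBregmanCoerciveP_of_hessian` : (C2ᴸ) ∧ (HSᴸ)(c) ⟹ (BCᴸ)(c) at all dials — `f'(0) = 0` by the criticality of `y` (chain rule,
  `HasDerivAt.unique`), then `f 1 − f 0 ≥ c·P` from `f'' ≥ 2c·P` (`taylor_lower_of_deriv2`, PROVED here from Mathlib's mean value inequality);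
  `offTubeGapMinP_record_of_hessian` ((OGᴹ′) at the record), door `mildCoherentMoatCorePG_W2i` (tree W2h with (BCᴸ′) replaced by the two pieces).
0 sorry · import = ZZZYJ (PART A) only · 2 defs (the `Prop` pieces (C2ᴸ)(HSᴸ)), 5 theorems · no instances/notation/options · axioms standard. [g94]
-/

noncomputable section
open scoped BigOperators Classical InnerProductSpace RealInnerProductSpace
open MeasureTheory Set Metric Filter Topology
open Literature.MathematicalPhysics.StatisticalMechanics (lennardJones)

namespace Summit.AtomisticToContinuum.Crystallization.Theorems.ChartedZeroExcessLayeredLatticeLiouville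

open Summit.AtomisticToContinuum.Crystallization.Theorems.ChartedPlanarOrderRigidityDoor (E3 IsClean)
open Summit.AtomisticToContinuum.Crystallization.Theorems.ChartedPlanarOrderDensityDichotomy (μS IsSep)
open Summit.AtomisticToContinuum.Crystallization.Theorems.ChartedPlanarOrderCleanScaleP (IsCleanP IsDoorSetP)
open Summit.AtomisticToContinuum.Crystallization.Theorems.ChartedPlanarOrderMesoCut (LayeredHom EnvClose)
open Summit.AtomisticToContinuum.Crystallization.Theorems.ChartedPlanarOrderDoorLayeredOsc (IsTwoShellAffineGood)
open Summit.AtomisticToContinuum.Crystallization.Theorems.ChartedPlanarOrderNashForceBalance (ljDeriv pairDeriv)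

/-! ### ZZZYK-1  One-variable Taylor in lower form (PROVED) -/

section Taylor

/-- ★ **ONE-VARIABLE TAYLOR, LOWER FORM (PROVED)**: if `f' = g` and `g' = h` on `[0, 1]`, `g 0 = 0` and `m ≤ h` on `[0, 1]`, then `f 0 + m/2 ≤ f 1`
(`g t ≥ m t` by the mean value inequality, then `t ↦ f t − (m/2)t²` is monotone). [this file, g94] -/
theorem taylor_lower_of_deriv2 {f g h : ℝ → ℝ} {m : ℝ} (hf : ∀ t ∈ Icc (0 : ℝ) 1, HasDerivAt f (g t) t)
    (hg : ∀ t ∈ Icc (0 : ℝ) 1, HasDerivAt g (h t) t) (hg0 : g 0 = 0) (hm : ∀ t ∈ Icc (0 : ℝ) 1, m ≤ h t) : f 0 + m / 2 ≤ f 1 := by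
  have hD : Convex ℝ (Icc (0 : ℝ) 1) := convex_Icc 0 1
  have hint : interior (Icc (0 : ℝ) 1) = Ioo 0 1 := interior_Icc
  have hg_cont : ContinuousOn g (Icc 0 1) := fun t ht => (hg t ht).continuousAt.continuousWithinAt
  have hg_diff : DifferentiableOn ℝ g (interior (Icc 0 1)) := fun t ht => by
    rw [hint] at ht
    exact (hg t (Ioo_subset_Icc_self ht)).differentiableAt.differentiableWithinAt
  have hg_ge : ∀ t ∈ interior (Icc (0 : ℝ) 1), m ≤ deriv g t := fun t ht => by
    rw [hint] at ht
    rw [(hg t (Ioo_subset_Icc_self ht)).deriv]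
    exact hm t (Ioo_subset_Icc_self ht)
  have hlin : ∀ t ∈ Icc (0 : ℝ) 1, m * t ≤ g t := fun t ht => by
    have := hD.mul_sub_le_image_sub_of_le_deriv hg_cont hg_diff hg_ge 0 (left_mem_Icc.2 zero_le_one) t ht ht.1
    simpa [hg0] using this
  have hF' : ∀ t ∈ Icc (0 : ℝ) 1, HasDerivAt (fun s => f s - m / 2 * (s * s)) (g t - m * t) t := fun t ht => by
    have h1 := ((hasDerivAt_id' t).mul (hasDerivAt_id' t)).const_mul (m / 2)
    have h2 := (hf t ht).sub h1
    refine h2.congr_deriv ?_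
    ring
  have hF_cont : ContinuousOn (fun s => f s - m / 2 * (s * s)) (Icc 0 1) := fun t ht => (hF' t ht).continuousAt.continuousWithinAt
  have hF_diff : DifferentiableOn ℝ (fun s => f s - m / 2 * (s * s)) (interior (Icc 0 1)) := fun t ht => by
    rw [hint] at ht
    exact (hF' t (Ioo_subset_Icc_self ht)).differentiableAt.differentiableWithinAt
  have hF_nonneg : ∀ t ∈ interior (Icc (0 : ℝ) 1), 0 ≤ deriv (fun s => f s - m / 2 * (s * s)) t := fun t ht => by
    rw [hint] at ht
    rw [(hF' t (Ioo_subset_Icc_self ht)).deriv]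
    linarith [hlin t (Ioo_subset_Icc_self ht)]
  have hmono := monotoneOn_of_deriv_nonneg hD hF_cont hF_diff hF_nonneg
  have h01 := hmono (left_mem_Icc.2 zero_le_one) (right_mem_Icc.2 zero_le_one) zero_le_one
  simp only at h01
  linarith

end Taylor

/-! ### ZZZYK-2  THE CUT OF (BCᴸ): (C2ᴸ) `ChordCalculusP` ∧ (HSᴸ) `SoftHessianStableP … c` ⟹ (BCᴸ)(c) (glue PROVED); door W2i -/

section Pieces

/-- ★★★ **(C2ᴸ) «ChordCalculusP … Rg sb₁ dI₁ dB₁ sb⁺ dI⁺ dB⁺ Rd τ …» — THE CHORD CALCULUS OF THE CLAMPED ENERGY (ANALYTIC · ROUTINE).**  Binders of (BCᴸ)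
VERBATIM; conclusion: for every soft fat-tube `z` there is a first-variation table `g : ℝ → ℝ` with `HasDerivAt (t ↦ clampedEnergy (S ∖ core) (y + t•(z − y))) (g t) t`
and `HasDerivAt g (clampedHessForm (S ∖ core) (y + t•(z − y)) (z − y)) t` at every `t ∈ [0, 1]` — the clamped energy is twice differentiable along the chord and its
second derivative IS the clamped Hessian form.  TRUE-type and routine: the chord is collision-free and at distance `≥ σ − dB⁺ − …` from the frozen exterior
(label separation `σ`, WINDOW-PIN, tube and softness radii `< σ/2`), the pair terms are smooth there (`hasFDerivAt_pair`, `hasDerivAt_ljDeriv`), and the exterior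
sums of first and second derivatives converge locally uniformly (`r⁻⁷`, `r⁻⁸` tails on a separated set: N-force-balance §4).  NOT in the tree: its derivative API
(`differentiableAt_clampedEnergy`, `hasFDerivAt_siteEnergy`) is stated AT ATOMS of `S` only.  ATTACKABLE-M (termwise `hasDerivAt_tsum` twice, ~600 lines).  No
stability content.
Why it might fail: only by mis-dialling (fat radii `≥ σ/2` letting a chord point collide with another site or an exterior atom, where `V_LJ ∘ ‖·‖` is not smooth).
Sources: tree N-force-balance (`hasFDerivAt_siteEnergy`, `hasFDerivAt_pair`), tree YK (`differentiableAt_clampedEnergy`), this file (`hasDerivAt_ljDeriv`). [this file, g94] -/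
def ChordCalculusP (ϑc ϑ ϑp r rΘ q rsh ρ rm σ ϑr Rs ε rI ℓ Rg sb₁ dI₁ dB₁ sbp dIp dBp Rd τ aHi Λ θ s : ℝ) : Prop :=
  ∀ δ : ℝ, 0 < δ → ∀ a : ℝ, 0 < a →
    ∀ S : Set E3, IsDoorSetP aHi δ S → (∀ z : E3, Summable fun y : S => lennardJones (dist z (y : E3))) →
      (∀ p ∈ S, IsTwoShellAffineGood θ S p) →
        ∀ (L : E3 ≃L[ℝ] E3) (w : ℤ → E3), IsEquilChart a s Λ L w →
          ∀ (x₀ : E3) (K : Set E3), K ⊆ S → (∀ k ∈ K, dist k x₀ ≤ q) →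
            IsTameOn ϑp S (LayeredHom (L : E3 →L[ℝ] E3) w) (coreOf S K rm) →
              IsTameOn ϑc S (LayeredHom (L : E3 →L[ℝ] E3) w) (moatIn S K r (r + rsh)) →
                ∀ (n : ℕ) (xf : Fin n → E3), Function.Injective xf → Set.range xf = coreOf S K ρ →
                  ∀ (L' : E3 →L[ℝ] E3) (w' : ℤ → E3) (U : E3 ≃ₗᵢ[ℝ] E3) (t : E3),
                    IsCoolShadowCrystal σ ϑr Rs ε r rI ℓ S K (LayeredHom (L : E3 →L[ℝ] E3) w) L' w' U t →
                      ∀ lab : E3 → E3, IsBondLabel ε rΘ ℓ S K (placedCrystal L' w' U t) lab →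
                        ∀ y ∈ bondTube (S \ coreOf S K ρ) Rg sb₁ dI₁ dB₁ (fun i => lab (xf i)),
                          Function.Injective y → Disjoint (Set.range y) (S \ coreOf S K ρ) →
                            HasFDerivAt (fun z : Fin n → E3 => clampedEnergy (S \ coreOf S K ρ) z) (0 : (Fin n → E3) →L[ℝ] ℝ) y →
                              (∀ i, IsTameStar ϑ ((S \ coreOf S K ρ) ∪ Set.range y) (LayeredHom (L : E3 →L[ℝ] E3) w) (y i)) →
                              (∀ z ∈ bondTube (S \ coreOf S K ρ) Rg sb₁ dI₁ dB₁ (fun i => lab (xf i)),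
                                  clampedEnergy (S \ coreOf S K ρ) y ≤ clampedEnergy (S \ coreOf S K ρ) z) →
                                ∀ z ∈ bondTube (S \ coreOf S K ρ) Rg sbp dIp dBp (fun i => lab (xf i)),
                                  IsSoftAbout Rd τ (fun i => lab (xf i)) y z →
                                    ∃ g : ℝ → ℝ,
                                      (∀ t ∈ Set.Icc (0 : ℝ) 1,
                                          HasDerivAt (fun s : ℝ => clampedEnergy (S \ coreOf S K ρ) (y + s • (z - y))) (g t) t) ∧
                                        ∀ t ∈ Set.Icc (0 : ℝ) 1,
                                          HasDerivAt g (clampedHessForm (S \ coreOf S K ρ) (y + t • (z - y)) (z - y)) t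

/-- ★★★ **(HSᴸ) «SoftHessianStableP … Rg sb₁ dI₁ dB₁ sb⁺ dI⁺ dB⁺ Rd τ c …» — CLAMPED PRE-STRESSED HARMONIC STABILITY ALONG SOFT CHORDS, IN THE `pairDevSq`
METRIC (THE CONTENT of (BCᴸ)).**  Binders of (BCᴸ) VERBATIM; conclusion: for every soft fat-tube `z` and every `t ∈ [0, 1]`,
`2c · pairDevSq Rg (lab ∘ xf) y z ≤ clampedHessForm (S ∖ core) (y + t•(z − y)) (z − y)` — the clamped Hessian form at every point of the chord, tested on the chord
direction, dominates the pair-deviation energy.  FINITE-DIMENSIONAL AT EACH CONFIGURATION · ALGEBRAIC (a quadratic-form inequality between two explicit bond sums;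
no energy differences, no minimality) · the CERTIFICATE TARGET of CRITIC-LEDGER row 1643 (c) («H − c·G ≽ 0», rational `LDLᵀ`) · INSTRUMENTABLE «SoftHessian-T»
(least generalised eigenvalue of `clampedHessForm` vs `pairDevSq` on record label patches, radius `16`; by WINDOW-PIN the scan must include UNIAXIAL stretches up to
`6.25 %` along single bond directions, not only the isotropic window) · STRONGER in form than (BCᴸ) (with (C2ᴸ) it integrates to it: `softBregmanCoerciveP_of_hessian`)
· WEAKER than full positive-definiteness (only chord directions `z − y` of soft fat-tube members are tested) · UNDECIDED.  TRUE-type by the desk estimate in the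
compressed and central window: the negative entries are the transverse pre-stress `|V'|/ℓ ≤ 0.52` of compressed nearest-neighbour bonds against longitudinal
stiffness `V'' ∈ [6, 113]` (ratio `≤ 0.061`), beaten by the CLAMPED RIM through a Korn-type inequality whose long-wave constant on the fcc nearest-neighbour truss
is `1/8` (softest `T₂[110]` shear; need `> 0.061`; continuum check `μ_min/p ≈ 2.2` at `27/32`) — a GLOBAL mechanism: local star forms are indefinite under
compression, so no compactly supported sum-of-squares certificate exists there; in the tensile window every nearest-neighbour term is nonnegative
(`bondHess_nonneg_of_stretched`) and only far-shell softening (`V'' < 0` beyond `1.1626`) competes.  Antitone in `c` (`.of_le`).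
Why it might fail: at the UNIAXIAL STRETCHED CORNER admitted by WINDOW-PIN (two bonds per site at `17/16`, filling `1.075`, chord points `1.100`, `V'' = 0.16`)
the margin is thin and unmeasured (g92's table covers isotropic stretch only); or a stacking with an anomalously soft clamped shear mode at radius `16`.
Sources: arXiv:1202.3858 §5.2 (lattice stability constant), doi:10.1051/m2an/2011014 (Hudson–Ortner), doi:10.1007/s00205-015-0862-1 (Flatley–Theil),
CRITIC-LEDGER row 1643 (c) (kernel certificate «H − cG»), STATUS «NO-PRESSURE-WINDOW» (g92), PART A ZZZYJ-2 (sign table). [this file, g94] -/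
def SoftHessianStableP (ϑc ϑ ϑp r rΘ q rsh ρ rm σ ϑr Rs ε rI ℓ Rg sb₁ dI₁ dB₁ sbp dIp dBp Rd τ c aHi Λ θ s : ℝ) : Prop :=
  ∀ δ : ℝ, 0 < δ → ∀ a : ℝ, 0 < a →
    ∀ S : Set E3, IsDoorSetP aHi δ S → (∀ z : E3, Summable fun y : S => lennardJones (dist z (y : E3))) →
      (∀ p ∈ S, IsTwoShellAffineGood θ S p) →
        ∀ (L : E3 ≃L[ℝ] E3) (w : ℤ → E3), IsEquilChart a s Λ L w →
          ∀ (x₀ : E3) (K : Set E3), K ⊆ S → (∀ k ∈ K, dist k x₀ ≤ q) →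
            IsTameOn ϑp S (LayeredHom (L : E3 →L[ℝ] E3) w) (coreOf S K rm) →
              IsTameOn ϑc S (LayeredHom (L : E3 →L[ℝ] E3) w) (moatIn S K r (r + rsh)) →
                ∀ (n : ℕ) (xf : Fin n → E3), Function.Injective xf → Set.range xf = coreOf S K ρ →
                  ∀ (L' : E3 →L[ℝ] E3) (w' : ℤ → E3) (U : E3 ≃ₗᵢ[ℝ] E3) (t : E3),
                    IsCoolShadowCrystal σ ϑr Rs ε r rI ℓ S K (LayeredHom (L : E3 →L[ℝ] E3) w) L' w' U t →
                      ∀ lab : E3 → E3, IsBondLabel ε rΘ ℓ S K (placedCrystal L' w' U t) lab →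
                        ∀ y ∈ bondTube (S \ coreOf S K ρ) Rg sb₁ dI₁ dB₁ (fun i => lab (xf i)),
                          Function.Injective y → Disjoint (Set.range y) (S \ coreOf S K ρ) →
                            HasFDerivAt (fun z : Fin n → E3 => clampedEnergy (S \ coreOf S K ρ) z) (0 : (Fin n → E3) →L[ℝ] ℝ) y →
                              (∀ i, IsTameStar ϑ ((S \ coreOf S K ρ) ∪ Set.range y) (LayeredHom (L : E3 →L[ℝ] E3) w) (y i)) →
                              (∀ z ∈ bondTube (S \ coreOf S K ρ) Rg sb₁ dI₁ dB₁ (fun i => lab (xf i)),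
                                  clampedEnergy (S \ coreOf S K ρ) y ≤ clampedEnergy (S \ coreOf S K ρ) z) →
                                ∀ z ∈ bondTube (S \ coreOf S K ρ) Rg sbp dIp dBp (fun i => lab (xf i)),
                                  IsSoftAbout Rd τ (fun i => lab (xf i)) y z →
                                    ∀ t ∈ Set.Icc (0 : ℝ) 1,
                                      2 * c * pairDevSq Rg (fun i => lab (xf i)) y z ≤ clampedHessForm (S \ coreOf S K ρ) (y + t • (z - y)) (z - y)

variable {ϑc ϑ ϑp r rΘ q rsh ρ rm σ ϑr Rs ε rI ℓ Rg sb₁ dI₁ dB₁ sbp dIp dBp Rd τ c c' aHi Λ θ s : ℝ}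

/-- (HSᴸ) is antitone in the modulus `c`. [formal bookkeeping] -/
theorem SoftHessianStableP.of_le (hc : c' ≤ c)
    (h : SoftHessianStableP ϑc ϑ ϑp r rΘ q rsh ρ rm σ ϑr Rs ε rI ℓ Rg sb₁ dI₁ dB₁ sbp dIp dBp Rd τ c aHi Λ θ s) :
    SoftHessianStableP ϑc ϑ ϑp r rΘ q rsh ρ rm σ ϑr Rs ε rI ℓ Rg sb₁ dI₁ dB₁ sbp dIp dBp Rd τ c' aHi Λ θ s := by
  intro δ hδ a ha S hS hsum hgood L w hLw x₀ K hKS hKq hmild hcool n xf hxf hrange L' w' U t hC lab hlab y hy hyinj hydisj hcrit htame hmin z hz hsoft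
    t' ht'
  have h1 := h δ hδ a ha S hS hsum hgood L w hLw x₀ K hKS hKq hmild hcool n xf hxf hrange L' w' U t hC lab hlab y hy hyinj hydisj hcrit htame hmin z hz
    hsoft t' ht'
  have h2 := mul_le_mul_of_nonneg_right hc (pairDevSq_nonneg Rg (fun i => lab (xf i)) y z)
  linarith

/-- ★★★ **THE GLUE OF NODE 94 (PROVED, all dials): (C2ᴸ) ∧ (HSᴸ)(c) ⟹ (BCᴸ)(c).**  Along the chord `f t = E(y + t•(z − y))`: `f' = g`, `g' = clampedHessForm ≥ 2c·P`
((C2ᴸ), (HSᴸ); `P = pairDevSq Rg (lab ∘ xf) y z`), and `g 0 = 0` because `y` is a critical point of the clamped energy (chain rule + `HasDerivAt.unique`); so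
`f 1 − f 0 ≥ c·P` (`taylor_lower_of_deriv2`), i.e. `c · pairDevSq ≤ E(z) − E(y)`. [this file, g94] -/
theorem softBregmanCoerciveP_of_hessian
    (hC2 : ChordCalculusP ϑc ϑ ϑp r rΘ q rsh ρ rm σ ϑr Rs ε rI ℓ Rg sb₁ dI₁ dB₁ sbp dIp dBp Rd τ aHi Λ θ s)
    (hHS : SoftHessianStableP ϑc ϑ ϑp r rΘ q rsh ρ rm σ ϑr Rs ε rI ℓ Rg sb₁ dI₁ dB₁ sbp dIp dBp Rd τ c aHi Λ θ s) :
    SoftBregmanCoerciveP ϑc ϑ ϑp r rΘ q rsh ρ rm σ ϑr Rs ε rI ℓ Rg sb₁ dI₁ dB₁ sbp dIp dBp Rd τ c aHi Λ θ s := by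
  intro δ hδ a ha S hS hsum hgood L w hLw x₀ K hKS hKq hmild hcool n xf hxf hrange L' w' U t hC lab hlab y hy hyinj hydisj hcrit htame hmin z hz hsoft
  obtain ⟨g, hf, hg⟩ := hC2 δ hδ a ha S hS hsum hgood L w hLw x₀ K hKS hKq hmild hcool n xf hxf hrange L' w' U t hC lab hlab y hy hyinj hydisj hcrit
    htame hmin z hz hsoft
  have hh := hHS δ hδ a ha S hS hsum hgood L w hLw x₀ K hKS hKq hmild hcool n xf hxf hrange L' w' U t hC lab hlab y hy hyinj hydisj hcrit htame hmin z hz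
    hsoft
  have hγ : HasDerivAt (fun s : ℝ => y + s • (z - y)) (z - y) 0 := by
    have h1 := ((hasDerivAt_id' (0 : ℝ)).smul_const (z - y)).const_add y
    simpa using h1
  have hcrit0 : HasFDerivAt (fun z : Fin n → E3 => clampedEnergy (S \ coreOf S K ρ) z) (0 : (Fin n → E3) →L[ℝ] ℝ) (y + (0 : ℝ) • (z - y)) := by
    simpa using hcrit
  have hcomp : HasDerivAt ((fun z : Fin n → E3 => clampedEnergy (S \ coreOf S K ρ) z) ∘ fun s : ℝ => y + s • (z - y))
      ((0 : (Fin n → E3) →L[ℝ] ℝ) (z - y)) 0 :=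
    hcrit0.comp_hasDerivAt (0 : ℝ) hγ
  have hg0 : g 0 = 0 := by
    have e := (hf 0 (left_mem_Icc.2 zero_le_one)).unique hcomp
    simpa using e
  have key := taylor_lower_of_deriv2 (m := 2 * c * pairDevSq Rg (fun i => lab (xf i)) y z) hf hg hg0 hh
  have e0 : y + (0 : ℝ) • (z - y) = y := by simp
  have e1 : y + (1 : ℝ) • (z - y) = z := by simp
  simp only [e0, e1] at key
  linarith

/-- ★★ **NODE 94 AT THE RECORD DIALS (PROVED): (KAᴸ′) ∧ (C2ᴸ′) ∧ (HSᴸ′)(c ≥ 0) ∧ (OGʰ′)(g₀) ⟹ (OGᴹ′)(min (c·(sb − sb₁)²) g₀)** — tree ZZZYI's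
`offTubeGapMinP_record_of_capture_hard` with (BCᴸ′) supplied by the glue. [this file, g94] -/
theorem offTubeGapMinP_record_of_hessian {σ ϑc ϑ sb₁ dI₁ dB₁ sbp dIp dBp Rd τ c g₀ : ℝ} (hσ : 1 / 2 ≤ σ) (hsb : sb₁ ≤ 249 / 5000) (hc : 0 ≤ c)
    (hKA : SoftCaptureP ϑc (1 / 10) 8 (145 / 16) 4 12 16 16 σ (1 / 10000) 5 (1 / 10000) 10 (43 / 2) (121 / 25) sb₁ dI₁ dB₁ sbp dIp dBp Rd τ 1 2
      (1 / 16) (1 / 50))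
    (hC2 : ChordCalculusP ϑc ϑ (1 / 10) 8 (145 / 16) 4 12 16 16 σ (1 / 10000) 5 (1 / 10000) 10 (43 / 2) (121 / 25) sb₁ dI₁ dB₁ sbp dIp dBp Rd τ 1 2
      (1 / 16) (1 / 50))
    (hHS : SoftHessianStableP ϑc ϑ (1 / 10) 8 (145 / 16) 4 12 16 16 σ (1 / 10000) 5 (1 / 10000) 10 (43 / 2) (121 / 25) sb₁ dI₁ dB₁ sbp dIp dBp Rd τ
      c 1 2 (1 / 16) (1 / 50))
    (hH : OffTubeHardGapMinP ϑc ϑ (1 / 10) 8 (145 / 16) 4 12 16 16 σ (1 / 10000) 5 (1 / 10000) 10 (43 / 2) (121 / 25) (249 / 5000) (249 / 5000)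
      (21 / 50) sb₁ dI₁ dB₁ Rd τ g₀ 1 2 (1 / 16) (1 / 50)) :
    OffTubeGapMinP ϑc ϑ (1 / 10) 8 (145 / 16) 4 12 16 16 σ (1 / 10000) 5 (1 / 10000) 10 (43 / 2) (121 / 25) (249 / 5000) (249 / 5000) (21 / 50)
      sb₁ dI₁ dB₁ (min (c * (249 / 5000 - sb₁) ^ 2) g₀) 1 2 (1 / 16) (1 / 50) :=
  offTubeGapMinP_record_of_capture_hard hσ hsb hc hKA (softBregmanCoerciveP_of_hessian hC2 hHS) hH

/-- ★★★ **THE DOOR W2i (PROVED): `ϑc ≤ 5·10⁻¹²`, (X1ᴸ′)(lam > 0), (X2ᴸ′), (KAᴸ′), (C2ᴸ′), (HSᴸ′)(c > 0) and (OGʰ′⋆)(g₀ > 0) ⟹ `[MCMC♮](ϑc)`** at the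
registered pair `(Rd, τ⋆) = (121/25, 249/10000)` — tree W2h with its Bregman leaf (BCᴸ′) replaced by NODE 94's two pieces. [this file, g94] -/
theorem mildCoherentMoatCorePG_W2i {ϑc sb₁ dI₁ dB₁ sbp dIp dBp lam c g₀ : ℝ} (hϑc : ϑc ≤ 1 / 200000000000) (hlam : 0 < lam) (hc : 0 < c) (hg₀ : 0 < g₀)
    (hsb : 4 * sb₁ ≤ 249 / 5000) (hdI : 4 * dI₁ ≤ 249 / 5000) (hdB : dB₁ ≤ 2 / 5) (hsb₀ : 0 ≤ sb₁) (hdI₀ : 0 ≤ dI₁) (hdB₀ : 0 ≤ dB₁)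
    (hX1 : LabelTubeConvexityP ϑc tameRadius (1 / 10) 8 (145 / 16) 4 12 16 16 (27 / 32) (1 / 10000) 5 (1 / 10000) 10 (43 / 2) (1 / 5000) (121 / 25)
      (249 / 5000) (249 / 5000) (21 / 50) lam 1 2 (1 / 16) (1 / 50))
    (hX2 : LabelLoadedTubeAprioriP ϑc tameRadius (1 / 10) 8 (145 / 16) 4 12 16 16 (27 / 32) (1 / 10000) 5 (1 / 10000) 10 (43 / 2) (1 / 5000)
      (121 / 25) (249 / 5000) (249 / 5000) (21 / 50) sb₁ dI₁ dB₁ 1 2 (1 / 16) (1 / 50))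
    (hKA : SoftCaptureP ϑc (1 / 10) 8 (145 / 16) 4 12 16 16 (27 / 32) (1 / 10000) 5 (1 / 10000) 10 (43 / 2) (121 / 25) sb₁ dI₁ dB₁ sbp dIp dBp
      (121 / 25) (249 / 10000) 1 2 (1 / 16) (1 / 50))
    (hC2 : ChordCalculusP ϑc tameRadius (1 / 10) 8 (145 / 16) 4 12 16 16 (27 / 32) (1 / 10000) 5 (1 / 10000) 10 (43 / 2) (121 / 25) sb₁ dI₁ dB₁
      sbp dIp dBp (121 / 25) (249 / 10000) 1 2 (1 / 16) (1 / 50))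
    (hHS : SoftHessianStableP ϑc tameRadius (1 / 10) 8 (145 / 16) 4 12 16 16 (27 / 32) (1 / 10000) 5 (1 / 10000) 10 (43 / 2) (121 / 25) sb₁ dI₁ dB₁
      sbp dIp dBp (121 / 25) (249 / 10000) c 1 2 (1 / 16) (1 / 50))
    (hH : OffTubeHardGapMinP ϑc tameRadius (1 / 10) 8 (145 / 16) 4 12 16 16 (27 / 32) (1 / 10000) 5 (1 / 10000) 10 (43 / 2) (121 / 25) (249 / 5000)
      (249 / 5000) (21 / 50) sb₁ dI₁ dB₁ (121 / 25) (249 / 10000) g₀ 1 2 (1 / 16) (1 / 50)) :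
    MildCoherentMoatCorePG ϑc tameRadius (1 / 10) 8 4 12 16 1 2 (1 / 16) (1 / 50) :=
  mildCoherentMoatCorePG_W2h hϑc hlam hc hg₀ hsb hdI hdB hsb₀ hdI₀ hdB₀ hX1 hX2 hKA (softBregmanCoerciveP_of_hessian hC2 hHS) hH

end Pieces

end Summit.AtomisticToContinuum.Crystallization.Theorems.ChartedZeroExcessLayeredLatticeLiouville
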